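import Literature.Barriers.CriticalPhenomena.WeaklySAWFlowTheorem
import HarnessLib

/-!
# [BBS-rg-flow, Theorem 1.4(i)] at a GENERAL cut-off `k`: existence and uniqueness of the flow of
# `Φ = (ψ, φ̄ + ρ)` with the bounds (1.11)–(1.14) for the weights `χ_j = Ω^{-(j-k)₊}`

`WeaklySAWFlowTheorem.lean` proves [BBS-rg-flow, Theorem 1.4(i)] (= BBS 2015, Theorem 7.2.1(i)) in the
printed form: from (A1)–(A2) it first derives the hypotheses of Lemmas 2.1–2.2 at the cut-off
`k = j_Ω` (`cutoffQuadHyp_of_hypA`), and the whole remaining argument (Lemmas 2.1–2.2, 4.1–4.3,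
the flow map `T`, the contraction) is carried out in this tree for an ARBITRARY cut-off `k ∈ ℕ ∪ {∞}`
with weights `χ_j = cutoffWeight Ω k j = Ω^{-(j-k)₊}` (`CutoffQuadHyp P Ω k …`; [BBS-rg-flow, §1.2:
"we assume that the sequence `χ_j` is given by `χ_j = Ω^{-(j-j_Ω)₊}` … the value of `j_Ω` is not
important"]). This file records the theorem in that generality — same proof, the derivation of
`CutoffQuadHyp` from (A1)–(A2) replaced by the hypothesis itself. This is the form needed when the
weights are FROZEN at the cut-off of a nearby external parameter, as in BBS 2015, §7.3 (Steps 2–3 of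
the proof of Proposition 7.1.1: "`χ̃_j = χ_j(m̃²)`" in the domains (Djdef-2)).

* **`BBS_thm14_exists_flow_cutoff`** — for `h : CutoffQuadHyp P Ω k B c ⌊c⁻¹⌋₊ C λ g₀`, `𝗁 ≥ 𝗁_*`,
  `0 < g₀ ≤ g_*` (the same thresholds `hThreshold`, `gThreshold`), (A3) with the weights
  `cutoffWeight Ω k` along `V̄(g₀)`, and `‖K₀‖ ≤ a_*g₀³`: the unique global flow with `(K₀, g₀)`
  prescribed, `(z_∞, μ_∞) = (0,0)`, in the domains, with the bounds (1.11)–(1.14).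
-/

noncomputable section

open Filter Topology Set
open scoped BigOperators ENNReal NNReal

namespace Literature.Barriers.CriticalPhenomena

namespace CTWSAW

set_option maxHeartbeats 1600000 in
/-- **[BBS-rg-flow, Theorem 1.4(i)] at a general cut-off `k`**: as `BBS_thm14_exists_flow`, with the
hypotheses of Lemmas 2.1–2.2 at the cut-off `k` (`CutoffQuadHyp P Ω k B c ⌊c⁻¹⌋₊ C λ g₀`) in place of
(A1)–(A2), and the weights `χ_j = Ω^{-(j-k)₊}` throughout ((A3), the domains `D_j`, the bounds
(1.11)–(1.14)). [cite: BauerschmidtBrydgesSlade2015Flow, Theorem 1.4(i) and §1.2 ("the value of j_Ω is not important")] [cite: BauerschmidtBrydgesSlade2015LogCorr, Theorem 7.2.1(i) and §7.3 (χ̃_j = χ_j(m̃²))] -/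
theorem BBS_thm14_exists_flow_cutoff {Ω B c lam C a κ R M aStar b : ℝ} (hΩ : 1 < Ω)
    (hκ : 0 < κ) (hκΩ : κ * Ω < 1) (hR : 0 < R) (hM : 0 < M) (haStar : R / (1 - κ * Ω) < aStar) (ha : aStar < a)
    (hb : 0 < b) (hb1 : b < 1) (hh : ℝ) (hhh : hThreshold Ω c C lam M a aStar κ b ≤ hh)
    {W : ℕ → Type*} [∀ j, NormedAddCommGroup (W j)] [∀ j, NormedSpace ℝ (W j)] [∀ j, CompleteSpace (W j)]
    (P : QuadFlowParams) (ψ : ∀ j, W j × V3 → W (j + 1)) (ρ : ∀ j, W j × V3 → V3) {g₀ : ℝ} {K₀ : W 0}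
    {k : ℕ∞} (h : CutoffQuadHyp P Ω k B c ⌊c⁻¹⌋₊ C lam g₀) (hg₀ : 0 < g₀)
    (hgs : g₀ ≤ gThreshold Ω B c C lam M a aStar κ R b hh)
    (hA3 : HypA3 (cutoffWeight Ω k) ψ ρ (P.flow g₀) a hh κ Ω R M) (hK₀ : ‖K₀‖ ≤ aStar * g₀ ^ 3) :
    ∃ x : ∀ j, W j × V3,
      (∀ j, x j ∈ flowDomain (cutoffWeight Ω k) (P.flow g₀) a hh j) ∧ IsPerturbedFlow P ψ ρ x ∧
      (x 0).1 = K₀ ∧ (x 0).2 0 = g₀ ∧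
      Tendsto (fun j => (x j).2 1) atTop (𝓝 0) ∧ Tendsto (fun j => (x j).2 2) atTop (𝓝 0) ∧
      FlowBounds (cutoffWeight Ω k) ψ (P.flow g₀) K₀ a aStar hh b x ∧
      ∀ x' : ∀ j, W j × V3, IsPerturbedFlow P ψ ρ x' → (x' 0).1 = K₀ → (x' 0).2 0 = g₀ →
        Tendsto (fun j => (x' j).2 1) atTop (𝓝 0) → Tendsto (fun j => (x' j).2 2) atTop (𝓝 0) →
        FlowBounds (cutoffWeight Ω k) ψ (P.flow g₀) K₀ a aStar hh b x' → x' = x := by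
  -- constants
  set C' : ℝ := sbarConst Ω c ⌊c⁻¹⌋₊ C lam * (27 / 8) with hC'
  set aK : ℝ := a - aStar with haK_def
  set q₀ : ℝ := ratioMargin Ω κ R aStar with hq₀
  set θ₀ : ℝ := (1 + κ * Ω) / 2 with hθ₀
  have hΩ0 : 0 < Ω := by linarith
  have h1κ : 0 < 1 - κ * Ω := by linarith
  have haK : 0 < aK := by rw [haK_def]; linarith
  have ha0 : 0 < aStar := lt_trans (div_pos hR h1κ) haStar
  have hB : 0 ≤ B := h.toCutoffGbarHyp.B_nonneg
  -- thresholds for `𝗁`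
  have hh1 : 1 ≤ hh := (le_max_left _ _).trans hhh
  have hh0 : 0 < hh := by linarith
  have hhA : 16 * C' * M * aK * Ω ≤ hh := ((le_max_left _ _).trans (le_max_right _ _)).trans hhh
  have hhB : 2 * C' * M / ((1 - κ * Ω) * b) ≤ hh := ((le_max_right _ _).trans (le_max_right _ _)).trans hhh
  -- thresholds for `g₀`
  have hge : g₀ ≤ Real.exp (-2) / 4 :=
    hgs.trans ((min_le_left _ _).trans ((min_le_left _ _).trans (min_le_right _ _)))
  have hgr : g₀ ≤ (1 - q₀⁻¹) / (6 * B + 1) := hgs.trans ((min_le_left _ _).trans (min_le_right _ _))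
  have hg3 : g₀ ≤ ((1 - κ * Ω) * aK / (64 * M * hh)) ^ 2 := hgs.trans ((min_le_right _ _).trans (min_le_left _ _))
  have hg4 : g₀ ≤ (1 / (8 * (C' + 1) * (512 * (2 * B + 14 * C) * Ω * hh * b + 8 * M))) ^ 2 / 2 :=
    hgs.trans ((min_le_right _ _).trans (min_le_right _ _))
  have hC : 0 ≤ C := h.C_nonneg
  have hC'0 : 0 ≤ C' := mul_nonneg h.sbarConst_nonneg (by norm_num)
  have hA3' : HypA3 (cutoffWeight Ω k) ψ ρ (P.flow g₀) a hh κ Ω R M := hA3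
  -- smallness of `g₀`: exponential thresholds
  have he2 : Real.exp (-2) ≤ Real.exp (-1) := Real.exp_le_exp.2 (by norm_num)
  have he1 : Real.exp (-2) ≤ 1 := by rw [← Real.exp_zero]; exact Real.exp_le_exp.2 (by norm_num)
  have hsmall1 : 4 * g₀ ≤ Real.exp (-1) := by linarith
  have hsmall2 : 2 * g₀ ≤ Real.exp (-2) := by linarith [Real.exp_pos (-2)]
  have hg1 : g₀ ≤ 1 := by linarith [Real.exp_pos (-2)]
  have h2g1 : 2 * g₀ ≤ 1 := by linarith
  -- the one-step ratio `ϑ ≤ Ωq₀`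
  have hq1 : 1 < q₀ := one_lt_ratioMargin hΩ0 hκ hκΩ hR haStar
  have hq0 : 0 < q₀ := by linarith
  have hcube : ((1 - 2 * B * g₀)⁻¹) ^ 3 ≤ q₀ := by
    refine inv_cube_le_of_small hB hg₀.le hq1.le ?_
    have h6 : 0 < 6 * B + 1 := by positivity
    have h7 := (le_div_iff₀ h6).1 hgr
    have e : g₀ * (6 * B + 1) = 6 * B * g₀ + g₀ := by ring
    linarith [hg₀.le]
  have hϑ : stepRatio Ω B g₀ ≤ Ω * q₀ := mul_le_mul_of_nonneg_left hcube hΩ0.le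
  have hϑ0 : 0 ≤ stepRatio Ω B g₀ := h.stepRatio_nonneg
  have hq2 : q₀ ≤ 2 := (min_le_left _ _).trans (min_le_left _ _)
  have hqR : q₀ ≤ (aStar - R) / (κ * aStar * Ω) := (min_le_left _ _).trans (min_le_right _ _)
  have hqκ : q₀ ≤ 1 + (1 - κ * Ω) / (4 * (κ * Ω)) := min_le_right _ _
  have hϑ2 : stepRatio Ω B g₀ ≤ 2 * Ω :=
    calc stepRatio Ω B g₀ ≤ Ω * q₀ := hϑ
      _ ≤ Ω * 2 := mul_le_mul_of_nonneg_left hq2 hΩ0.le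
      _ = 2 * Ω := by ring
  have hϑR : R + κ * aStar * stepRatio Ω B g₀ ≤ aStar := by
    have hpos : 0 < κ * aStar * Ω := by positivity
    have h1 : q₀ * (κ * aStar * Ω) ≤ aStar - R := (le_div_iff₀ hpos).1 hqR
    have h2 : κ * aStar * stepRatio Ω B g₀ ≤ κ * aStar * (Ω * q₀) :=
      mul_le_mul_of_nonneg_left hϑ (by positivity)
    have h3 : κ * aStar * (Ω * q₀) = q₀ * (κ * aStar * Ω) := by ring
    linarith
  have hϑκ : κ * stepRatio Ω B g₀ ≤ κ * Ω + (1 - κ * Ω) / 4 := by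
    have hkΩ : 0 < κ * Ω := by positivity
    calc κ * stepRatio Ω B g₀ ≤ κ * (Ω * q₀) := mul_le_mul_of_nonneg_left hϑ hκ.le
      _ = κ * Ω * q₀ := by ring
      _ ≤ κ * Ω * (1 + (1 - κ * Ω) / (4 * (κ * Ω))) := mul_le_mul_of_nonneg_left hqκ hkΩ.le
      _ = κ * Ω + (1 - κ * Ω) / 4 := by field_simp
  -- Lemma 1.3 along `x̄` and the ball data
  have hχ : ∀ j, 0 ≤ cutoffWeight Ω k j := fun j => (h.weight_pos j).le
  have hgb : ∀ j, 0 ≤ P.flow g₀ j 0 := fun j => by rw [QuadFlowParams.flow_apply_zero]; exact (h.gbar_pos j).le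
  have hKbar : ∀ j, ‖Kbar ψ (P.flow g₀) K₀ j‖ ≤ aStar * cutoffWeight Ω k j * gbar P.β g₀ j ^ 3 := by
    intro j
    have hratio : ∀ j, cutoffWeight Ω k j * P.flow g₀ j 0 ^ 3 ≤
        stepRatio Ω B g₀ * (cutoffWeight Ω k (j + 1) * P.flow g₀ (j + 1) 0 ^ 3) := fun j => by
      simpa [QuadFlowParams.flow_apply_zero, stepRatio] using h.toCutoffGbarHyp.weight_cube_le_mul_succ j
    have hK₀' : ‖K₀‖ ≤ aStar * cutoffWeight Ω k 0 * P.flow g₀ 0 0 ^ 3 := by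
      rw [cutoffWeight_eq_one_of_le (by simp), QuadFlowParams.flow_apply_zero, gbar_zero]; simpa using hK₀
    have := hA3'.norm_Kbar_le hχ hgb hh0.le ha0.le ha.le hratio hϑR hK₀' j
    simpa [QuadFlowParams.flow_apply_zero] using this
  have hBall : CutoffQuadHyp.BallHyp P ψ Ω (k) g₀ hh a aStar b K₀ :=
    ⟨hh0, hb, hb1.le, ha0.le, ha, hKbar, hsmall1, hsmall2⟩
  -- the solution operator and its norm
  set S := h.sbarVP hBall.small1 hBall.hh_pos with hS_def
  have hSn : ‖S‖ ≤ C' := h.norm_sbarVP_le hBall.small1 hBall.hh_pos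
  -- `ε`-bounds
  have hε1 : epsLog g₀ ≤ 2 * Real.sqrt g₀ := epsLog_le_sqrt hg₀ hg1
  have hε2 : epsLogSq g₀ ≤ 32 * Real.sqrt g₀ := by
    have h16 := epsLogSq_le_sqrt hg₀ h2g1
    have : Real.sqrt (2 * g₀) ≤ 2 * Real.sqrt g₀ := by
      rw [Real.sqrt_le_left (by positivity)]
      nlinarith [Real.sq_sqrt hg₀.le, Real.sqrt_nonneg g₀]
    linarith
  have hε10 := h.epsLog_nonneg; have hε20 := h.epsLogSq_nonneg
  have hsg0 : 0 ≤ Real.sqrt g₀ := Real.sqrt_nonneg _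
  have hsq3 : Real.sqrt g₀ ≤ (1 - κ * Ω) * aK / (64 * M * hh) := by
    have hx : 0 ≤ (1 - κ * Ω) * aK / (64 * M * hh) := by positivity
    calc Real.sqrt g₀ ≤ Real.sqrt (((1 - κ * Ω) * aK / (64 * M * hh)) ^ 2) := Real.sqrt_le_sqrt hg3
      _ = _ := Real.sqrt_sq hx
  set X : ℝ := 1 / (8 * (C' + 1) * (512 * (2 * B + 14 * C) * Ω * hh * b + 8 * M)) with hX
  have hBC : 0 ≤ 2 * B + 14 * C := by positivity
  have hden : 0 < 8 * (C' + 1) * (512 * (2 * B + 14 * C) * Ω * hh * b + 8 * M) := by positivity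
  have hX0 : 0 ≤ X := by rw [hX]; positivity
  have hsq4 : Real.sqrt g₀ ≤ X := by
    have : g₀ ≤ X ^ 2 := hg4.trans (by linarith [sq_nonneg X])
    calc Real.sqrt g₀ ≤ Real.sqrt (X ^ 2) := Real.sqrt_le_sqrt this
      _ = X := Real.sqrt_sq hX0
  -- the smallness conditions with `θ = θ₀ = (1 + κΩ)/2`
  have hθ0 : 0 ≤ θ₀ := by rw [hθ₀]; positivity
  have hθ1 : θ₀ < 1 := by rw [hθ₀]; linarith
  have hθhalf : 1 / 2 ≤ θ₀ := by
    have hk : 0 ≤ κ * Ω := by positivity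
    rw [hθ₀]; linarith only [hk]
  have hlipK : lipK Ω B g₀ κ M hh aK ≤ θ₀ := by
    unfold lipK
    have ht : 4 * M * epsLog g₀ * hh / aK ≤ (1 - κ * Ω) / 8 := by
      rw [div_le_iff₀ haK]
      calc 4 * M * epsLog g₀ * hh ≤ 4 * M * (2 * Real.sqrt g₀) * hh := by gcongr
        _ ≤ 4 * M * (2 * ((1 - κ * Ω) * aK / (64 * M * hh))) * hh := by gcongr
        _ = (1 - κ * Ω) / 8 * aK := by field_simp; ring
    rw [hθ₀]; linarith only [hϑκ, ht, h1κ]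
  have hlipN : ‖S‖ * lipN Ω B C g₀ M hh aK b ≤ θ₀ := by
    have hLN : 0 ≤ lipN Ω B C g₀ M hh aK b := by unfold lipN; positivity
    have t1 : C' * (M * aK * stepRatio Ω B g₀ / hh) ≤ 1 / 8 := by
      rw [mul_div_assoc', div_le_iff₀ hh0]
      calc C' * (M * aK * stepRatio Ω B g₀) ≤ C' * (M * aK * (2 * Ω)) := by gcongr
        _ = (16 * C' * M * aK * Ω) / 8 := by ring
        _ ≤ hh / 8 := by gcongr
        _ = 1 / 8 * hh := by ring
    have t2 : C' * (8 * (2 * B + 14 * C) * Ω * epsLogSq g₀ * hh * b + 4 * M * epsLog g₀) ≤ 1 / 8 := by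
      set Q : ℝ := (2 * B + 14 * C) * Ω * hh * b with hQ
      have hQ0 : 0 ≤ Q := by rw [hQ]; positivity
      have a1 : C' * (256 * Q + 8 * M) ≤ (C' + 1) * (512 * Q + 8 * M) :=
        mul_le_mul (by linarith) (by linarith) (by positivity) (by positivity)
      have hden' : 8 * (C' + 1) * (512 * Q + 8 * M) ≠ 0 := by positivity
      calc C' * (8 * (2 * B + 14 * C) * Ω * epsLogSq g₀ * hh * b + 4 * M * epsLog g₀)
          ≤ C' * (8 * (2 * B + 14 * C) * Ω * (32 * Real.sqrt g₀) * hh * b + 4 * M * (2 * Real.sqrt g₀)) := by gcongr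
        _ = C' * (256 * Q + 8 * M) * Real.sqrt g₀ := by rw [hQ]; ring
        _ ≤ (C' + 1) * (512 * Q + 8 * M) * X := mul_le_mul a1 hsq4 hsg0 (by positivity)
        _ = 1 / 8 := by
            rw [hX, show 512 * (2 * B + 14 * C) * Ω * hh * b = 512 * Q by rw [hQ]; ring]
            field_simp
    calc ‖S‖ * lipN Ω B C g₀ M hh aK b ≤ C' * lipN Ω B C g₀ M hh aK b := mul_le_mul_of_nonneg_right hSn hLN
      _ = C' * (M * aK * stepRatio Ω B g₀ / hh) +
          C' * (8 * (2 * B + 14 * C) * Ω * epsLogSq g₀ * hh * b + 4 * M * epsLog g₀) := by unfold lipN; ring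
      _ ≤ 1 / 8 + 1 / 8 := add_le_add t1 t2
      _ ≤ θ₀ := by linarith
  have hball : ‖S‖ * (M / hh) + θ₀ * b ≤ b := by
    have t : C' * (M / hh) ≤ (1 - κ * Ω) * b / 2 := by
      rw [mul_div_assoc', div_le_iff₀ hh0]
      have h1 := (div_le_iff₀ (by positivity : 0 < (1 - κ * Ω) * b)).1 hhB
      have e3 : (1 - κ * Ω) * b / 2 * hh = hh * ((1 - κ * Ω) * b) / 2 := by ring
      linarith
    have h2 : ‖S‖ * (M / hh) ≤ C' * (M / hh) := mul_le_mul_of_nonneg_right hSn (by positivity)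
    have e1 : θ₀ * b = b / 2 + κ * Ω * b / 2 := by rw [hθ₀]; ring
    have e2 : (1 - κ * Ω) * b / 2 = b / 2 - κ * Ω * b / 2 := by ring
    linarith
  have hSmall : CutoffQuadHyp.SmallHyp Ω B C g₀ κ M hh (a - aStar) b θ₀ S := ⟨hθ0, hθ1, hlipK, hlipN, hball⟩
  obtain ⟨x, hdom, hfl, hK0', hg0', tz, tμ, hbd⟩ := h.exists_perturbedFlow hA3' hBall hSmall
  refine ⟨x, hdom, hfl, hK0', hg0', tz, tμ, hbd, fun x' hfl' hK0'' hg0'' tz' tμ' hbd' => ?_⟩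
  exact (h.perturbedFlow_unique hA3' hBall hSmall hfl hK0' hg0' tz tμ hbd hfl' hK0'' hg0'' tz' tμ' hbd').symm

end CTWSAW

end Literature.Barriers.CriticalPhenomena
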